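import Summits.CriticalPhenomena.PercolationContinuityZ3.Theorems.PercNearOneGluingNoHeavyQuantFarGate3Patch_B_s0
import Summits.CriticalPhenomena.PercolationContinuityZ3.Theorems.PercNearOneGluingNoHeavyQuantFarGate3Patch_B_s1
import Summits.CriticalPhenomena.PercolationContinuityZ3.Theorems.PercNearOneGluingNoHeavyQuantFarGate3Patch_B_s2
import Summits.CriticalPhenomena.PercolationContinuityZ3.Theorems.PercNearOneGluingNoHeavyQuantFarGate3Patch_B_s3
import Summits.CriticalPhenomena.PercolationContinuityZ3.Theorems.PercNearOneGluingNoHeavyQuantFarGate3Patch_B_s4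
import Summits.CriticalPhenomena.PercolationContinuityZ3.Theorems.PercNearOneGluingNoHeavyQuantFarGate3Patch_B_s5
import Summits.CriticalPhenomena.PercolationContinuityZ3.Theorems.PercNearOneGluingNoHeavyQuantFarGate3Reduce8
import HarnessLib

/-!
# QUANT lane R8, front "FAR beyond trees", layer one — THE DEGREE-THREE GATE AT THE OBSERVER: patchwork `B` — rectangle theorem `red8_patch_B`

builds on p205010 (kernel theorem, internal audit signed; external expert review pending)

Support file (`--supports stmt-CriticalPhenomena-4575`), seat `prim-quant-p1` (gen 32); memo
`run/shared/lean/prim/quant/prim-quant-p1-g32/FOR-LEAD-GATE3-CHARTC.md` §3 (patchwork).  GENERATED by `work/chartc/gen_patchwork.py`; standard axioms; no sorries; no definitions.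

Rectangle theorem of patchwork `B`: the 8-cell cover statement for every `0 < p < 1/20`, `1/5 ≤ min(r₁,r₂)`, `max(r₁,r₂) ≤ 4/5` (both `≤ 1`... `< 1` by `r2hi < 1`), all `nn ≥ 1`; strips: [1/5,3/10], [3/10,2/5], [2/5,1/2], [1/2,3/5], [3/5,7/10], [7/10,4/5].
[cite: KozmaNitzan2024, Conjecture 3 (p. 15)]; [this work].
-/

noncomputable section

namespace Summit.CriticalPhenomena.PercolationContinuityZ3.Theorems

namespace Quant

namespace Gate3

/-- `r₁ ≤ r₂` case. [this work] -/
theorem red8_patch_B_of_le (p r₁ r₂ nn : ℝ) (hp0 : 0 < p) (hp : p < ((1 : ℝ) / 20)) (h1lo : ((1 : ℝ) / 5) ≤ r₁) (h12 : r₁ ≤ r₂) (h2hi : r₂ ≤ ((4 : ℝ) / 5)) (hn : 1 ≤ nn) :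
    ∀ (a0 a1 a2 b1 b2 c0 c1 d : ℝ), 0 ≤ a0 → 0 ≤ a1 → 0 ≤ a2 → 0 ≤ b1 → 0 ≤ b2 → 0 ≤ c0 → 0 ≤ c1 → 0 ≤ d →
    b1 * (b2 + (c0 + c1)) ≤ (a0 + a1 + a2) * d →
    b2 * (b1 + (c0 + c1)) ≤ (a0 + a1 + a2) * d →
    (c0 + c1) * (b1 + b2) ≤ (a0 + a1 + a2) * d →
    b1 * (a1 + a2 + c1 + d) ≤ d * (a0 + b1 + b2 + c0) →
    b2 * (a1 + a2 + c1 + d) ≤ d * (a0 + b1 + b2 + c0) →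
    c0 * (a1 + a2 + c1 + d) ≤ (c1 + d) * (a0 + b1 + b2 + c0) →
    0 < p * ((1 - r₁) * (1 - r₂)) * (a0 + c0) - (1 - p) * a2 - (1 - p) * ((1 - r₁) * (1 - r₂)) * d →
    0 < (1 - p) * (1 - r₁) * b1 - p * (r₂ * (1 - r₁)) * a0 - p * (1 - r₁) * a1 - (1 - p * r₁) * a2 - (1 - (1 - p) * (1 - r₂)) * (1 - r₁) * b2 - p * ((1 - r₁) * (1 - r₂)) * c1 →
    0 < (1 - p) * (1 - r₂) * b2 - p * (r₁ * (1 - r₂)) * a0 - p * (1 - r₂) * a1 - (1 - p * r₂) * a2 - (1 - (1 - p) * (1 - r₁)) * (1 - r₂) * b1 - p * ((1 - r₁) * (1 - r₂)) * c1 →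
    0 < (1 - p * max r₁ r₂ - nn * p * (1 - max r₁ r₂)) * a1 + (1 - p * (r₁ + r₂ * (1 - r₁)) - nn * p * ((1 - r₁) * (1 - r₂))) * c1 - nn * p * (r₁ + r₂ * (1 - r₁) - max r₁ r₂) * a0 - nn * ((1 - (1 - p) * (1 - r₁)) * (1 - r₂)) * b1 - nn * ((1 - (1 - p) * (1 - r₂)) * (1 - r₁)) * b2 →
    0 < (p * (1 + r₁ + r₂ + nn * max r₁ r₂) - 2) * a0 + (p * (1 + r₁ + r₂) + p * max r₁ r₂ * (nn - 1) - 1) * a1 + (p * (1 + r₁ + r₂) + nn - 2) * a2 + ((1 - (1 - p) * (1 - r₁)) * (1 + r₂ * (nn + 1)) - 1) * b1 + ((1 - (1 - p) * (1 - r₂)) * (1 + r₁ * (nn + 1)) - 1) * b2 + (p * (1 + (nn + 2) * (r₁ + r₂ * (1 - r₁))) - 2) * c0 + (p * (1 + (nn + 1) * (r₁ + r₂ * (1 - r₁))) - 1) * c1 + (nn + 1 - (1 - p) * ((1 - r₁) * (1 - r₂))) * d →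
    False := by
  have hr2 : r₂ < 1 := by linarith
  have _b : r₁ ≤ ((4 : ℝ) / 5) := by linarith
  rcases le_total r₁ ((1 : ℝ) / 2) with hcut | hcut
  · rcases le_total r₁ ((3 : ℝ) / 10) with hcut | hcut
    · exact B_s0 p r₁ r₂ nn hp0 hp (by linarith) (by linarith) h12 h2hi hr2 hn
    · rcases le_total r₁ ((2 : ℝ) / 5) with hcut | hcut
      · exact B_s1 p r₁ r₂ nn hp0 hp (by linarith) (by linarith) h12 h2hi hr2 hn
      · exact B_s2 p r₁ r₂ nn hp0 hp (by linarith) (by linarith) h12 h2hi hr2 hn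
  · rcases le_total r₁ ((3 : ℝ) / 5) with hcut | hcut
    · exact B_s3 p r₁ r₂ nn hp0 hp (by linarith) (by linarith) h12 h2hi hr2 hn
    · rcases le_total r₁ ((7 : ℝ) / 10) with hcut | hcut
      · exact B_s4 p r₁ r₂ nn hp0 hp (by linarith) (by linarith) h12 h2hi hr2 hn
      · exact B_s5 p r₁ r₂ nn hp0 hp (by linarith) (by linarith) h12 h2hi hr2 hn

/-- **Patchwork `B`: the 8-cell cover statement for `0 < p < 1/20`, `r₁, r₂ ∈ [1/5, 4/5]`, every real `nn ≥ 1`.** [this work] -/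
theorem red8_patch_B (p r₁ r₂ nn : ℝ) (hp0 : 0 < p) (hp : p < ((1 : ℝ) / 20)) (h1lo : ((1 : ℝ) / 5) ≤ r₁) (h1hi : r₁ ≤ ((4 : ℝ) / 5)) (h2lo : ((1 : ℝ) / 5) ≤ r₂) (h2hi : r₂ ≤ ((4 : ℝ) / 5)) (hn : 1 ≤ nn) :
    ∀ (a0 a1 a2 b1 b2 c0 c1 d : ℝ), 0 ≤ a0 → 0 ≤ a1 → 0 ≤ a2 → 0 ≤ b1 → 0 ≤ b2 → 0 ≤ c0 → 0 ≤ c1 → 0 ≤ d →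
    b1 * (b2 + (c0 + c1)) ≤ (a0 + a1 + a2) * d →
    b2 * (b1 + (c0 + c1)) ≤ (a0 + a1 + a2) * d →
    (c0 + c1) * (b1 + b2) ≤ (a0 + a1 + a2) * d →
    b1 * (a1 + a2 + c1 + d) ≤ d * (a0 + b1 + b2 + c0) →
    b2 * (a1 + a2 + c1 + d) ≤ d * (a0 + b1 + b2 + c0) →
    c0 * (a1 + a2 + c1 + d) ≤ (c1 + d) * (a0 + b1 + b2 + c0) →
    0 < p * ((1 - r₁) * (1 - r₂)) * (a0 + c0) - (1 - p) * a2 - (1 - p) * ((1 - r₁) * (1 - r₂)) * d →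
    0 < (1 - p) * (1 - r₁) * b1 - p * (r₂ * (1 - r₁)) * a0 - p * (1 - r₁) * a1 - (1 - p * r₁) * a2 - (1 - (1 - p) * (1 - r₂)) * (1 - r₁) * b2 - p * ((1 - r₁) * (1 - r₂)) * c1 →
    0 < (1 - p) * (1 - r₂) * b2 - p * (r₁ * (1 - r₂)) * a0 - p * (1 - r₂) * a1 - (1 - p * r₂) * a2 - (1 - (1 - p) * (1 - r₁)) * (1 - r₂) * b1 - p * ((1 - r₁) * (1 - r₂)) * c1 →
    0 < (1 - p * max r₁ r₂ - nn * p * (1 - max r₁ r₂)) * a1 + (1 - p * (r₁ + r₂ * (1 - r₁)) - nn * p * ((1 - r₁) * (1 - r₂))) * c1 - nn * p * (r₁ + r₂ * (1 - r₁) - max r₁ r₂) * a0 - nn * ((1 - (1 - p) * (1 - r₁)) * (1 - r₂)) * b1 - nn * ((1 - (1 - p) * (1 - r₂)) * (1 - r₁)) * b2 →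
    0 < (p * (1 + r₁ + r₂ + nn * max r₁ r₂) - 2) * a0 + (p * (1 + r₁ + r₂) + p * max r₁ r₂ * (nn - 1) - 1) * a1 + (p * (1 + r₁ + r₂) + nn - 2) * a2 + ((1 - (1 - p) * (1 - r₁)) * (1 + r₂ * (nn + 1)) - 1) * b1 + ((1 - (1 - p) * (1 - r₂)) * (1 + r₁ * (nn + 1)) - 1) * b2 + (p * (1 + (nn + 2) * (r₁ + r₂ * (1 - r₁))) - 2) * c0 + (p * (1 + (nn + 1) * (r₁ + r₂ * (1 - r₁))) - 1) * c1 + (nn + 1 - (1 - p) * ((1 - r₁) * (1 - r₂))) * d →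
    False := by
  rcases le_total r₁ r₂ with h12 | h21
  · exact red8_patch_B_of_le p r₁ r₂ nn hp0 hp h1lo h12 h2hi hn
  · exact red8_symm p r₁ r₂ nn (red8_patch_B_of_le p r₂ r₁ nn hp0 hp h2lo h21 h1hi hn)

end Gate3

end Quant

end Summit.CriticalPhenomena.PercolationContinuityZ3.Theorems
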